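import Mathlib.NumberTheory.PrimeCounting
import Mathlib.Algebra.Polynomial.Eval.Defs
import Mathlib.RingTheory.Polynomial.Basic
import Mathlib.NumberTheory.LegendreSymbol.ZModChar
import Mathlib.Topology.Algebra.InfiniteSum.Basic
import Literature.NumberTheory.Sieve.SingularSeries
import HarnessLib

-- provenance: harness21/H21/H21/Prelude/AntSieve/BatemanHorn.lean @ ec52c55 (interim HEAD d8f2665); M5 mechanical rewrite
/-!
# The Bateman–Horn constant

Trunk T-ANT / T-SIEVE (outline `AntSieve.md`, §C11, design decisions D-SIEVE-1, D-SIEVE-2), notion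
`bateman_horn_constant`.

For a finite family `f : ι → ℤ[X]` of integer polynomials we define

* `Literature.polyRootCountMod f p` — `ω_f(p)`, the number of `n mod p` with `p ∣ ∏ᵢ fᵢ(n)`;
* `Literature.HasNoFixedPrimeDivisor f` — `ω_f(p) < p` for every prime `p`;
* `Literature.IsBatemanHornSystem f` — the Bateman–Horn hypotheses (irreducible, positive leading
  coefficients, pairwise non-associated, no fixed prime divisor);
* `Literature.batemanHornPartial f x = ∏_{p ≤ x} (1 - 1/p)^{-k} (1 - ω_f(p)/p)` and the Bateman–Horn
  constant `Literature.batemanHornConst f = lim_{x → ∞} batemanHornPartial f x` (an *ordered* limit,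
  D-SIEVE-1), together with the predicate `Literature.HasBatemanHornConst f C`;
* `Literature.polyPrimeCount f x` — `#{n ≤ x : every fᵢ(n) is a (positive) prime}`;
* `Literature.NumberTheory.Sieve.hardyLittlewoodEConst` — the constant of Hardy–Littlewood's Conjecture E (primes `n² + 1`),
  i.e. the Bateman–Horn constant of the single polynomial `X² + 1`.

Mathlib (at the pinned commit) has no Bateman–Horn material (searched `BatemanHorn`,
`batemanHorn`); we use its anchors `Polynomial.eval`, `Irreducible`, `Polynomial.leadingCoeff`,
`Associated`, `Nat.primesLE`, `Filter.limUnder`, `ZMod.χ₄`, and the accepted H21 module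
`Literature.Prelude.AntSieve.SingularSeries` (`tupleResidueCount`) for the linear-tuple bridge.

## Design choices

* (D-SIEVE-1) The Euler product `∏_p (1 - 1/p)^{-k}(1 - ω_f(p)/p)` is only conditionally
  convergent, so `batemanHornConst` is the ordered limit `limUnder atTop` of the partial products
  over `Nat.primesLE x`, paired with the `Tendsto` predicate `HasBatemanHornConst`. When the limit
  does not exist `batemanHornConst` is a junk value; statements needing the value should assume
  `HasBatemanHornConst f C` or `IsBatemanHornSystem f` (see `exists_hasBatemanHornConst`).
* (D-SIEVE-2) The family is unbundled, `f : ι → ℤ[X]` over a `Fintype` index; `ω_f(p)` is counted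
  in `ℕ` over `Finset.range p` (junk `0` at `p = 0`).
* `polyPrimeCount` demands `0 < fᵢ(n)` explicitly before `Int.toNat`, so no junk primes arise.

## References

* P. T. Bateman, R. A. Horn, *A heuristic asymptotic formula concerning the distribution of prime
  numbers*, Math. Comp. 16 (1962), 363–367, §2.
* G. H. Hardy, J. E. Littlewood, *Some problems of 'Partitio Numerorum' III*, Acta Math. 44
  (1923), 1–70, Conjectures E, F.
-/

noncomputable section

open Filter Finset Polynomial
open scoped Topology

namespace Literature.NumberTheory.Sieve

variable {ι : Type*} [Fintype ι]

/-! ### Local root counts and the Bateman–Horn hypotheses -/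

/-- `ω_f(p)`: the number of residues `n ∈ {0, …, p-1}` with `p ∣ ∏ᵢ fᵢ(n)`, i.e. the number of
solutions of `∏ᵢ fᵢ ≡ 0 (mod p)`. (Junk `0` for `p = 0`.) Bateman–Horn, Math. Comp. 16 (1962),
§1. [folklore] -/
def polyRootCountMod (f : ι → ℤ[X]) (p : ℕ) : ℕ :=
  #((range p).filter fun n : ℕ ↦ (p : ℤ) ∣ ∏ i, (f i).eval (n : ℤ))

/-- The family `f` has *no fixed prime divisor*: for every prime `p` some `n` has
`p ∤ ∏ᵢ fᵢ(n)`, i.e. `ω_f(p) < p`. Bateman–Horn, Math. Comp. 16 (1962), §1. [folklore] -/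
def HasNoFixedPrimeDivisor (f : ι → ℤ[X]) : Prop :=
  ∀ p : ℕ, p.Prime → polyRootCountMod f p < p

/-- The hypotheses of the Bateman–Horn conjecture on a finite family `f : ι → ℤ[X]`: every `fᵢ`
is irreducible with positive leading coefficient, the `fᵢ` are pairwise non-associated (no two
differ by a unit `±1`), and the product has no fixed prime divisor. Bateman–Horn, Math. Comp. 16
(1962), §1. [folklore] -/
structure IsBatemanHornSystem (f : ι → ℤ[X]) : Prop where
  /-- Each `fᵢ` is irreducible in `ℤ[X]` (in particular non-constant or a prime constant; the
  positivity and no-fixed-divisor conditions exclude constants). -/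
  irreducible : ∀ i, Irreducible (f i)
  /-- Each `fᵢ` has positive leading coefficient. -/
  leadingCoeff_pos : ∀ i, 0 < (f i).leadingCoeff
  /-- The `fᵢ` are pairwise non-associated. -/
  pairwise_not_associated : Pairwise fun i j ↦ ¬Associated (f i) (f j)
  /-- `∏ᵢ fᵢ` has no fixed prime divisor. -/
  hasNoFixedPrimeDivisor : HasNoFixedPrimeDivisor f

/-! ### The Bateman–Horn constant -/

/-- Ordered partial product `∏_{p ≤ x} (1 - 1/p)^{-k} (1 - ω_f(p)/p)` of the Bateman–Horn
constant, `k = card ι` (D-SIEVE-1). Bateman–Horn, Math. Comp. 16 (1962), (2). [folklore] -/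
def batemanHornPartial (f : ι → ℤ[X]) (x : ℕ) : ℝ :=
  ∏ p ∈ Nat.primesLE x,
    (1 - 1 / (p : ℝ))⁻¹ ^ Fintype.card ι * (1 - (polyRootCountMod f p : ℝ) / p)

/-- `HasBatemanHornConst f C`: the ordered partial products `∏_{p ≤ x} (1 - 1/p)^{-k}(1 - ω_f(p)/p)`
converge to `C` as `x → ∞`. Bateman–Horn, Math. Comp. 16 (1962), (2). [folklore] -/
def HasBatemanHornConst (f : ι → ℤ[X]) (C : ℝ) : Prop :=
  Tendsto (batemanHornPartial f) atTop (𝓝 C)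

/-- The Bateman–Horn constant `C(f) = ∏_p (1 - 1/p)^{-k} (1 - ω_f(p)/p)` as an ordered limit
(D-SIEVE-1; junk if the limit does not exist, cf. `exists_hasBatemanHornConst`). Bateman–Horn,
Math. Comp. 16 (1962), (2). [folklore] -/
def batemanHornConst (f : ι → ℤ[X]) : ℝ :=
  limUnder atTop (batemanHornPartial f)

/-- `P_f(x) = #{n ≤ x : fᵢ(n) is a (positive) prime for every i}`, the Bateman–Horn counting
function. Bateman–Horn, Math. Comp. 16 (1962), (1). [folklore] -/
def polyPrimeCount (f : ι → ℤ[X]) (x : ℕ) : ℕ :=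
  #((range (x + 1)).filter fun n : ℕ ↦
    ∀ i, 0 < (f i).eval (n : ℤ) ∧ ((f i).eval (n : ℤ)).toNat.Prime)

/-- The Hardy–Littlewood Conjecture E constant: the Bateman–Horn constant of the single polynomial
`X² + 1`, `∏_p (1 - 1/p)^{-1}(1 - ω(p)/p) = ∏_{p > 2} (1 - χ₋₄(p)/(p - 1))`
(see `tendsto_hardyLittlewoodE_partial`). Hardy–Littlewood, Acta Math. 44 (1923), Conjecture E;
Bateman–Horn 1962, §3. [cite: BatemanHorn1962, §3] -/
def hardyLittlewoodEConst : ℝ :=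
  batemanHornConst ![(X ^ 2 + 1 : ℤ[X])]

/-! ### API -/

/-- For a Bateman–Horn system the Euler product converges (conditionally, by the prime ideal
theorem in the splitting fields of the `fᵢ`) to a positive limit. Bateman–Horn, Math. Comp. 16
(1962), §2. [cite: BatemanHornMathComp1962, §2 (convergence of the product via the prime ideal theorem)] -/
def exists_hasBatemanHornConst : Prop :=
  ∀ {f : ι → ℤ[X]} (hf : IsBatemanHornSystem f),
    ∃ C, 0 < C ∧ HasBatemanHornConst f C

/-- If the partial products converge to `C` then `batemanHornConst f = C`. [folklore] -/
theorem HasBatemanHornConst.batemanHornConst_eq {f : ι → ℤ[X]} {C : ℝ}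
    (h : HasBatemanHornConst f C) : batemanHornConst f = C :=
  Tendsto.limUnder_eq h

/-- For a Bateman–Horn system, the partial products converge to `batemanHornConst f`, which is
positive. Bateman–Horn, Math. Comp. 16 (1962), §2. [folklore] -/
def IsBatemanHornSystem.hasBatemanHornConst : Prop :=
  ∀ {f : ι → ℤ[X]} (hf : IsBatemanHornSystem f),
    HasBatemanHornConst f (batemanHornConst f) ∧ 0 < batemanHornConst f

/- interim proof relied on results that are now named facts (D-0014); demoted to a fact by the M5 import, proof preserved:
:= by
  obtain ⟨C, hC, h⟩ := exists_hasBatemanHornConst hf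
  rw [h.batemanHornConst_eq]
  exact ⟨h, hC⟩
-/

/-- Trivial bound `ω_f(p) ≤ p`. [folklore] -/
theorem polyRootCountMod_le (f : ι → ℤ[X]) (p : ℕ) : polyRootCountMod f p ≤ p := by
  unfold polyRootCountMod
  exact (card_filter_le _ _).trans (card_range p).le

/-- Bridge to admissible tuples (§C10): for the linear system `fₕ = X + h`, `h ∈ H`, and a prime
`p`, `ω_f(p) = ν_H(p)` is the number of residue classes mod `p` occupied by `H` (namely
`n ≡ -h`). Bateman–Horn 1962, §3; Halberstam–Richert ch. 10. [cite: BatemanHorn1962, §3] -/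
def polyRootCountMod_linear_eq_tupleResidueCount : Prop :=
  ∀ (H : Finset ℤ) {p : ℕ} (hp : p.Prime),
    polyRootCountMod (fun h : H ↦ (X + C (h : ℤ) : ℤ[X])) p = tupleResidueCount H p

/-- The linear system `(X + h)_{h ∈ H}` has no fixed prime divisor iff `H` is admissible. [folklore] -/
def hasNoFixedPrimeDivisor_linear_iff : Prop :=
  ∀ (H : Finset ℤ),
    HasNoFixedPrimeDivisor (fun h : H ↦ (X + C (h : ℤ) : ℤ[X])) ↔ IsAdmissibleTuple H

/- interim proof relied on results that are now named facts (D-0014); demoted to a fact by the M5 import, proof preserved: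
:= by
  simp only [HasNoFixedPrimeDivisor, IsAdmissibleTuple]
  refine forall₂_congr fun p hp ↦ ?_
  rw [polyRootCountMod_linear_eq_tupleResidueCount H hp]
-/

/-- For an odd prime `p`, `x² + 1 ≡ 0 (mod p)` has `1 + χ₋₄(p)` solutions (two if `p ≡ 1 mod 4`,
none if `p ≡ 3 mod 4`), by the first supplement to quadratic reciprocity. Hardy–Littlewood 1923,
Conjecture E; Bateman–Horn 1962, §3. [cite: HardyLittlewood1923, Conjecture E] -/
def polyRootCountMod_X_sq_add_one : Prop :=
  ∀ {p : ℕ} (hp : p.Prime) (hp2 : p ≠ 2),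
    (polyRootCountMod ![(X ^ 2 + 1 : ℤ[X])] p : ℤ) = 1 + ZMod.χ₄ p

/-- `ω_{X²+1}(2) = 1`. [folklore] -/
theorem polyRootCountMod_X_sq_add_one_two : polyRootCountMod ![(X ^ 2 + 1 : ℤ[X])] 2 = 1 := by
  simp only [polyRootCountMod, Fin.prod_univ_one, Matrix.cons_val_fin_one, eval_add, eval_pow,
    eval_X, eval_one]
  decide

/-- Hardy–Littlewood's form of the Conjecture E constant: the ordered partial products
`∏_{2 < p ≤ x} (1 - χ₋₄(p)/(p - 1))` converge to `hardyLittlewoodEConst` (the `p = 2` factor of the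
Bateman–Horn product is `(1 - 1/2)^{-1}(1 - 1/2) = 1`, and for odd `p`,
`(1 - 1/p)^{-1}(1 - (1 + χ₋₄(p))/p) = 1 - χ₋₄(p)/(p-1)`). Hardy–Littlewood, Acta Math. 44 (1923),
Conjecture E, (5.42); Bateman–Horn 1962, §3. [cite: BatemanHorn1962, §3] -/
def tendsto_hardyLittlewoodE_partial : Prop :=
  Tendsto (fun x : ℕ ↦ ∏ p ∈ (Nat.primesLE x).filter (2 < ·),
      (1 - (ZMod.χ₄ p : ℝ) / ((p : ℝ) - 1))) atTop (𝓝 hardyLittlewoodEConst)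

end Literature.NumberTheory.Sieve
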